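import Literature.Barriers.PneNP.MCSPHardnessObstructionsProofs
import Literature.Computability.Complexity.TruncMapMachine
import Literature.Computability.Complexity.NTIMEPadding
import Literature.Computability.Complexity.NPClosureProofs
import HarnessLib

/-!
# Murray–Williams 2017, Thm. 4.1: the sparse padded `NP` language of an `NTIME(2ⁿ)` language

Step "Define the padded language `L' := {x01^{2^{|x|^c}} | x ∈ L}`. The language `L'` is then a
sparse language in `NP`" of the printed proof of Murray–Williams' Theorem 4.1 (Theory of
Computing 13 (2017), p. 14 = CCC 2015, p. 374), for the tree's verifier-form `NTIME` and the
linear-exponential pad `lpad 1 x = ⟨1^{2^{|x|}} 0 1^{|x|}, x⟩` of `ExpTimeMaps.lean` (after the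
polynomial padding `NTIME(2^{nᵏ}) ↝ NTIME(2ⁿ)` of `NTIMEPadding.lean`, an `NTIME(2ⁿ)` seed is what
Thm. 4.1 needs). Main result:

* **`KarpAssembly.exists_sparse_pad_mem_NP`**: for `L ∈ NTIME(2ⁿ)` there is a SPARSE language
  `L♯ ∈ NP` with `x ∈ L ↔ lpad 1 x ∈ L♯` for all `x`.

The language is `L♯ = PadFmt ⊓ logTruncLang L`, where `logTruncLang L = {w | logTruncFn w ∈ L}`
is the truncation language of `MCSPHardnessObstructionsProofs.lean` (`logTruncFn w` = the second
pair component cut to `size |w|` bits, so that `logTruncFn (lpad 1 x) = x`) and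
`PadFmt = {w | lpad 1 (logTruncFn w) = w}` is the set of well-formed pads:

* `KarpAssembly.logTruncLang_mem_NP`: `L ∈ NTIME(2ⁿ) ⇒ logTruncLang L ∈ NP` — the verifier on
  `⟨w, y⟩` is the truncating wrapper `truncMapAux` (`TruncMapMachine.lean`) for the clock
  `w ↦ expClock c 1 (logTruncFn w) = ⟨x, 1^{c·2^{|x|}+c}⟩`, `x = logTruncFn w` (so the witness is
  CUT to the admissible length of the `NTIME` verifier `M`, which is then run on
  `⟨x, y ↾ (c·2^{|x|}+c)⟩`); as `2^{|x|} ≤ 2|w| + 2`, everything is polynomial in `|⟨w, y⟩|`;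
* `KarpAssembly.padFmt_mem_P`: `PadFmt ∈ P` (`lpad 1 ∘ logTruncFn ∈ FP`: the `2^{O(n)}`-time pad
  runs on a logarithmically short word; equality test `setOf_apply_eq_apply_mem_P`);
* `KarpAssembly.ncard_padFmt_slice_le`: at most `N` well-formed pads of each length `N`
  (sparseness; cf. `ncard_padLang_slice_le` of `ExpPadding.lean`).

## References

* C. D. Murray, R. R. Williams, *On the (non) NP-hardness of computing circuit complexity*,
  Theory of Computing 13 (2017), Thm. 4.1 and its proof (p. 14); CCC 2015 version, pp. 374–375.
* S. Arora, B. Barak, *Computational Complexity: A Modern Approach*, CUP 2009, §2.6.2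
  (padding, Thm. 2.22), Def. 2.1, §1.3.
-/

namespace Literature.Barriers.PneNP

open _root_.Computability Turing Polynomial Literature.Computability.Complexity
  Literature.Computability.Complexity.Nondeterministic Literature.Computability.Complexity.PairFstTM

namespace KarpAssembly

/-! ### The truncation is logarithmically short: `2^{|logTruncFn w|} ≤ 2|w| + 2` -/

/-- `2^{log₂ N + 1} ≤ 2N + 2`. [folklore] -/
theorem two_pow_log_succ_le (N : ℕ) : 2 ^ (Nat.log 2 N + 1) ≤ 2 * N + 2 := by
  rcases Nat.eq_zero_or_pos N with rfl | hN
  · simp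
  · have := Nat.pow_log_le_self 2 hN.ne'
    rw [pow_succ]
    omega

/-- `2^{|logTruncFn w|} ≤ 2|w| + 2`. [folklore] -/
theorem two_pow_length_logTruncFn_le (w : List Bool) : 2 ^ (logTruncFn w).length ≤ 2 * w.length + 2 :=
  (Nat.pow_le_pow_right Nat.two_pos (length_logTruncFn_le w)).trans (two_pow_log_succ_le _)

/-- `2^{c (log₂ N + 1)} ≤ (2N + 2)^c`. [folklore] -/
theorem two_pow_mul_log_succ_le (c N : ℕ) : 2 ^ (c * (Nat.log 2 N + 1)) ≤ (2 * N + 2) ^ c := by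
  rw [mul_comm, pow_mul]
  exact Nat.pow_le_pow_left (two_pow_log_succ_le N) c

/-! ### `logTruncLang L ∈ NP` for `L ∈ NTIME(2ⁿ)` -/

/-- **The clock of the verifier**: some machine maps every word `w` to
`expClock c 1 (logTruncFn w) = ⟨x, 1^{c·2^{|x|}+c}⟩`, `x = logTruncFn w`, within `q(|w|)` steps for
a polynomial `q` (the `FP` machine of `logTruncFn` followed by the clock program of
`NTIMEPadding.lean`, which takes `C · 2^{|x|} + C ≤ C (2|w| + 2) + C` steps). [folklore] -/
theorem exists_logTrunc_clock_machine (c : ℕ) :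
    ∃ (q : Polynomial ℕ) (N : TM2ComputableAux Bool Bool), ∀ w : List Bool,
      N.OutputsWithin w (expClock c 1 (logTruncFn w)) (q.eval w.length) := by
  obtain ⟨p, U, hU⟩ := logTruncFn_mem_FP
  obtain ⟨C, Ck, hCk⟩ := exists_timeComputable_expClock c (k := 1) le_rfl
  refine ⟨p + Polynomial.C C * (2 * X + 2) + Polynomial.C C, U.comp Ck, fun w => ?_⟩
  have h := TM2ComputableAux.comp_outputsWithin U Ck (hU w) (hCk (logTruncFn w))
  refine h.mono ?_
  have e1 := Nat.mul_le_mul_left C (two_pow_length_logTruncFn_le w)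
  simp only [id, pow_one, eval_add, eval_mul, eval_C, eval_X, eval_ofNat]
  linarith [e1]

/-- **`L ∈ NTIME(2ⁿ) ⇒ logTruncLang L ∈ NP`.** Let `(c, R, M)` present `L`. The witness language is
`V = {u | R x ((readRest u) ↾ B) = 1}` with `x = logTruncFn (fst u)`, `B = c · 2^{|x|} + c`: it is
in `P`, decided by the truncating wrapper `truncMapAux` for the clock above (output
`⟨x, y ↾ B⟩` on `⟨w, y⟩`) followed by `M`, which on such an admissible pair halts within `B`
steps — and `B ≤ c (2|w| + 2) + c`. Correctness: `w ∈ logTruncLang L ↔ x ∈ L ↔ ∃ y, |y| ≤ B ∧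
R x y = 1`, and such `y` are exactly the kept parts of witnesses of length `≤ c(2|w|+2)+c`.
[cite: MurrayWilliams2017, Thm. 4.1 (proof: "The language L' is then a sparse language in NP")]
[cite: AroraBarak2009, §2.6.2 (Thm. 2.22)] -/
theorem logTruncLang_mem_NP {L : Language Bool} (hL : L ∈ NTIME (fun n => 2 ^ n)) :
    logTruncLang L ∈ NP := by
  obtain ⟨c, R, M, hM, hLR⟩ := hL
  obtain ⟨q, Nc, hNc⟩ := exists_logTrunc_clock_machine c
  -- the witness language, through its defining equation
  obtain ⟨V, hV⟩ : ∃ V : Language Bool, V = {u | R (logTruncFn (boolUnpair u).1)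
      ((readRest u).take (c * 2 ^ (logTruncFn (boolUnpair u).1).length + c)) = true} := ⟨_, rfl⟩
  have hmemV : ∀ u : List Bool, u ∈ V ↔ R (logTruncFn (boolUnpair u).1)
      ((readRest u).take (c * 2 ^ (logTruncFn (boolUnpair u).1).length + c)) = true := fun u => by
    rw [hV]
    exact Iff.rfl
  -- `V ∈ P`: truncate the witness, then run `M`
  have hVP : V ∈ Classes.P := by
    refine timeClass_subset_P_of_polynomial_holds
      (q + Polynomial.C (9 * c + 12) * X + Polynomial.C (9 * c + 12)) ?_
    refine ⟨(truncMapAux Nc).comp M, fun u => ?_⟩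
    have hclock := hNc (boolUnpair u).1
    have h₁ := outputsWithin_truncMapAux Nc (z := u) hclock
    simp only [List.length_replicate, pow_one] at h₁
    have hy' : ((readRest u).take (c * 2 ^ (logTruncFn (boolUnpair u).1).length + c)).length ≤
        c * 2 ^ (logTruncFn (boolUnpair u).1).length + c := List.length_take_le _ _
    have h₂ := hM (logTruncFn (boolUnpair u).1) _ hy'
    have h := TM2ComputableAux.comp_outputsWithin _ _ h₁ h₂
    have hind : R (logTruncFn (boolUnpair u).1)
        ((readRest u).take (c * 2 ^ (logTruncFn (boolUnpair u).1).length + c)) = V.boolIndicator u := by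
      rw [Bool.eq_iff_iff]
      exact ⟨fun h => (Set.mem_iff_boolIndicator _ _).1 ((hmemV u).2 h),
        fun h => (hmemV u).1 ((Set.mem_iff_boolIndicator _ _).2 h)⟩
    rw [hind] at h
    refine h.mono ?_
    -- the estimates, all polynomial in `|u|`
    have hwu : (boolUnpair u).1.length ≤ u.length := length_boolUnpair_fst_le u
    have hx : (logTruncFn (boolUnpair u).1).length ≤ (boolUnpair u).1.length + 1 :=
      (length_logTruncFn_le _).trans (Nat.succ_le_succ (Nat.log_le_self 2 _))
    have hpow : 2 ^ (logTruncFn (boolUnpair u).1).length ≤ 2 * (boolUnpair u).1.length + 2 :=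
      two_pow_length_logTruncFn_le _
    have hr : (readRest u).length ≤ u.length := by
      have := readSteps_add_le u
      have := one_le_readSteps u
      omega
    have hsub : u.length - (readRest u).length ≤ u.length := Nat.sub_le _ _
    have hdiv : (readRest u).length / 2 ≤ u.length := (Nat.div_le_self _ _).trans hr
    have hq : q.eval (boolUnpair u).1.length ≤ q.eval u.length := TM2Iter.eval_mono q hwu
    have e1 : c * 2 ^ (logTruncFn (boolUnpair u).1).length ≤ c * (2 * u.length + 2) :=
      Nat.mul_le_mul_left c (hpow.trans (by omega))
    simp only [id, eval_add, eval_mul, eval_C, eval_X]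
    linarith [e1, hq, hx, hwu, hsub, hdiv, Nat.zero_le (c * u.length)]
  -- the `NP` presentation
  refine ⟨V, hVP, Polynomial.C c * (2 * X + 2) + Polynomial.C c, fun w => ?_⟩
  have hmem : ∀ y : List Bool, boolPair w y ∈ V ↔
      R (logTruncFn w) (y.take (c * 2 ^ (logTruncFn w).length + c)) = true := fun y => by
    simp only [hmemV, boolUnpair_boolPair, readRest_boolPair]
  have hB : c * 2 ^ (logTruncFn w).length + c ≤ c * (2 * w.length + 2) + c :=
    Nat.add_le_add_right (Nat.mul_le_mul_left c (two_pow_length_logTruncFn_le w)) c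
  change logTruncFn w ∈ L ↔ _
  rw [hLR (logTruncFn w)]
  simp only [eval_add, eval_mul, eval_C, eval_X, eval_ofNat]
  constructor
  · rintro ⟨y, hy, hRy⟩
    refine ⟨y, hy.trans hB, (hmem y).2 ?_⟩
    rwa [List.take_of_length_le hy]
  · rintro ⟨y, -, hy⟩
    exact ⟨_, List.length_take_le _ _, (hmem y).1 hy⟩

/-! ### The well-formed pads: `PadFmt = {w | lpad 1 (logTruncFn w) = w} ∈ P` -/

/-- **Re-padding the truncation is polynomial time**: `lpad 1 ∘ logTruncFn ∈ FP` — the pad runs in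
time `K · 2^{c n} + K` (`lpad_mem_FE`) on a word of length `n ≤ log₂ N + 1`, and
`2^{c (log₂ N + 1)} ≤ (2N + 2)^c` (`TimeComputable.comp_holds`). [cite: AroraBarak2009, §1.3 (Claim 1.6)] -/
theorem lpad_comp_logTruncFn_mem_FP : lpad 1 ∘ logTruncFn ∈ FP := by
  obtain ⟨c, K, hK⟩ := mem_FE_iff.1 (lpad_mem_FE 1)
  obtain ⟨p, hp⟩ := logTruncFn_mem_FP
  obtain ⟨C, hC⟩ := TimeComputable.comp_holds hK hp (monotone_expLin c K) (s := fun N => Nat.log 2 N + 1)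
    length_logTruncFn_le
  refine ⟨Polynomial.C C * (p + (Polynomial.C K * (2 * X + 2) ^ c + Polynomial.C K) + (X + 1)) +
    Polynomial.C C, hC.mono fun N => ?_⟩
  have h1 := two_pow_mul_log_succ_le c N
  have h2 : Nat.log 2 N ≤ N := Nat.log_le_self 2 N
  simp only [eval_add, eval_mul, eval_C, eval_X, eval_pow, eval_ofNat, eval_one]
  gcongr

/-- **`PadFmt ∈ P`**: the set `{w | lpad 1 (logTruncFn w) = w}` of well-formed pads is decidable in
polynomial time (equality test of two `FP` maps). [cite: MurrayWilliams2017, Thm. 4.1 (proof)] -/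
theorem padFmt_mem_P : ({w | lpad 1 (logTruncFn w) = w} : Language Bool) ∈ Classes.P := by
  have h := setOf_apply_eq_apply_mem_P lpad_comp_logTruncFn_mem_FP OracleCompose.id_mem_FP
  simpa only [Function.comp_apply, id_eq] using h

/-- Pads are well formed: `lpad 1 x ∈ PadFmt`. [folklore] -/
theorem lpad_mem_padFmt (x : List Bool) : lpad 1 x ∈ ({w | lpad 1 (logTruncFn w) = w} : Language Bool) := by
  change lpad 1 (logTruncFn (lpad 1 x)) = lpad 1 x
  rw [logTruncFn_lpad le_rfl]

/-! ### Sparseness: at most `N` well-formed pads of each length `N` -/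

/-- The length of a pad, `2 (2^n + n + 1) + 2 + n`, is strictly monotone in the payload length `n`.
[folklore] -/
theorem strictMono_length_lpad_one : StrictMono fun n : ℕ => 2 * (2 ^ (1 * n) + 1 * n + 1) + 2 + n := by
  refine strictMono_nat_of_lt_succ fun n => ?_
  have : 2 ^ (1 * n) ≤ 2 ^ (1 * (n + 1)) := Nat.pow_le_pow_right Nat.two_pos (by omega)
  show 2 * (2 ^ (1 * n) + 1 * n + 1) + 2 + n < 2 * (2 ^ (1 * (n + 1)) + 1 * (n + 1) + 1) + 2 + (n + 1)
  omega

/-- **Sparseness of the well-formed pads**: at most `N` words `w` of length `N` satisfy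
`lpad 1 (logTruncFn w) = w` (they are pads `lpad 1 x` of words `x` of one and the same length `n`,
and `2ⁿ ≤ |lpad 1 x| = N`). (Murray–Williams: "The language `L'` is then a sparse language".)
[cite: MurrayWilliams2017, Thm. 4.1 (proof)] -/
theorem ncard_padFmt_slice_le (S : Language Bool) (hS : ∀ w ∈ S, lpad 1 (logTruncFn w) = w) (N : ℕ) :
    {w : List Bool | w ∈ S ∧ w.length = N}.ncard ≤ N := by
  by_cases hN : ∃ x₀ : List Bool, (lpad 1 x₀).length = N
  · obtain ⟨x₀, hx₀⟩ := hN
    -- every member of the slice is the pad of a word of length `|x₀|`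
    have hsub : {w : List Bool | w ∈ S ∧ w.length = N} ⊆
        (fun v : List.Vector Bool x₀.length => lpad 1 v.toList) '' Set.univ := by
      rintro w ⟨hwS, hw⟩
      have hw' : lpad 1 (logTruncFn w) = w := hS w hwS
      have hlen : (lpad 1 (logTruncFn w)).length = (lpad 1 x₀).length := by rw [hw', hw, hx₀]
      rw [length_lpad, length_lpad] at hlen
      have hxl : (logTruncFn w).length = x₀.length := strictMono_length_lpad_one.injective hlen
      refine ⟨⟨logTruncFn w, hxl⟩, Set.mem_univ _, ?_⟩
      show lpad 1 (List.Vector.toList ⟨logTruncFn w, hxl⟩) = w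
      rw [List.Vector.toList_mk]
      exact hw'
    have hfin : ((fun v : List.Vector Bool x₀.length => lpad 1 v.toList) '' Set.univ).Finite :=
      Set.finite_univ.image _
    calc {w : List Bool | w ∈ S ∧ w.length = N}.ncard
        ≤ ((fun v : List.Vector Bool x₀.length => lpad 1 v.toList) '' Set.univ).ncard :=
          Set.ncard_le_ncard hsub hfin
      _ ≤ (Set.univ : Set (List.Vector Bool x₀.length)).ncard := Set.ncard_image_le Set.finite_univ
      _ = 2 ^ x₀.length := by
          rw [Set.ncard_univ, Nat.card_eq_fintype_card, card_vector, Fintype.card_bool]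
      _ ≤ N := by
          have h := two_pow_le_length_lpad 1 x₀
          rw [one_mul, hx₀] at h
          exact h
  · have : {w : List Bool | w ∈ S ∧ w.length = N} = ∅ := by
      ext w
      simp only [Set.mem_setOf_eq, Set.mem_empty_iff_false, iff_false, not_and]
      intro hwS hlen
      exact hN ⟨logTruncFn w, by rw [hS w hwS, hlen]⟩
    rw [this, Set.ncard_empty]
    exact Nat.zero_le _

/-! ### The sparse padded `NP` language -/

/-- **The sparse `NP` pad of an `NTIME(2ⁿ)` language** (Murray–Williams 2017, proof of Thm. 4.1:
"Define the padded language `L' := {x01^{2^{|x|^c}} | x ∈ L}`. The language `L'` is then a sparse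
language in `NP`"; here `L♯ = PadFmt ⊓ logTruncLang L = {lpad 1 x | x ∈ L}` with the pad
`lpad 1 x = ⟨1^{2^{|x|}} 0 1^{|x|}, x⟩`): for `L ∈ NTIME(2ⁿ)` there is a sparse `L♯ ∈ NP` with
`x ∈ L ↔ lpad 1 x ∈ L♯`. [cite: MurrayWilliams2017, Thm. 4.1 (proof, p. 14)] -/
theorem exists_sparse_pad_mem_NP {L : Language Bool} (hL : L ∈ NTIME (fun n => 2 ^ n)) :
    ∃ Lp : Language Bool, Lp ∈ NP ∧ IsSparseLanguage Lp ∧ ∀ x : List Bool, x ∈ L ↔ lpad 1 x ∈ Lp := by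
  refine ⟨{w | lpad 1 (logTruncFn w) = w} ⊓ logTruncLang L, ?_, ?_, fun x => ?_⟩
  · exact inter_P_mem_polyExists (fun _ _ h₁ h₂ => inter_mem_P h₁ h₂) padFmt_mem_P
      (logTruncLang_mem_NP hL)
  · refine ⟨1, fun N => ?_⟩
    rw [pow_one]
    exact (ncard_padFmt_slice_le _ (fun w hw => hw.1) N).trans (Nat.le_succ N)
  · change x ∈ L ↔ lpad 1 x ∈ ({w | lpad 1 (logTruncFn w) = w} : Language Bool) ∧ lpad 1 x ∈ logTruncLang L
    rw [lpad_mem_logTruncLang_iff le_rfl]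
    exact ⟨fun hx => ⟨lpad_mem_padFmt x, hx⟩, fun h => h.2⟩

end KarpAssembly

end Literature.Barriers.PneNP
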